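import Literature.NumberTheory.EllipticCurves.IsogenySelmerGroupsComposite
import Literature.NumberTheory.EllipticCurves.SquareClassAverageMarkovProofs
import HarnessLib

/-!
# Bhargava–Klagsbrun–Lemke Oliver–Shnidman 2019, Theorem 2.5 (a) in Selmer form — the §9.1–9.2
# argument replayed in the kernel

Cross-ladder literature-typing layer (cell `bsd-littype`, seat 08, gen 6). Theorems only (no
definitions, no named facts). Source: Bhargava–Klagsbrun–Lemke Oliver–Shnidman, Duke Math. J.
**168** (2019) = arXiv:1709.09790 (REFEREED), §9.1–9.2 (held text `paper:arxiv-1709.09790`, chunk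
p0014), with the convexity inequality of Bhargava–Elkies–Shnidman, J. Lond. Math. Soc. **101**
(2020), display (8.2) (held text `paper:arxiv-1610.05759`, chunk p0017 L29–L33).

BKLOS §9.2 (p0014 L43): "Let `T_m(φ)` be as in the previous proof, so that the average of the rank
of `Sel₃(E_s)` for `s ∈ T₀(φ)` is at most `1`. The only additional input needed is a result of
Cassels which shows that if `s ∈ T_m(φ)`, then `dim_{𝔽₃} Sel₃(E_s) ≡ m (mod 2)`. In particular, every
twist within `T₀(φ)` has even `3`-Selmer rank, so it follows that at least `50%` of the twists in
`T₀(φ)` have rank `0`." The printed Theorem 2.5 (a) records the conclusion as "rank `0`" (typed as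
`thm25_proportions`, `ThreeIsogenySelmerRatioTwistFamilies.lean`); the argument proves the stronger
SELMER statement "`Sel₃(E_s) = 0` for at least `½ μ(T₀(φ))` of the classes", which is what a
`3`-converse theorem consumes (Keller–Yin's Cor. 3.8.1 (B2) road, `OPEN-QUESTIONS-08.md` §I
BKLOS-Q4). This file derives that Selmer statement in the kernel from the four REFEREED named facts
of `IsogenySelmerGroups.lean` / `IsogenySelmerGroupsComposite.lean`:

* `thm21_averageCard_selmerGroup` (BKLOS Thm. 2.1: average `#Sel_{φ_s}(E_s) = 1 + avg c(φ_s)`),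
* `casselsFormula_selmerRatio` (Cassels' formula, BKLOS (9.2)),
* `selmerRank_parity_of_isInSelmerRatioClass` (BES Prop. 42 (ii)),
* `lemma91_selmerGroup_exact` (BKLOS Lemma 9.1),

following §9.1 verbatim: on `T₀(φ)` one has `c(φ_s) = 1` (Cassels: `c` is a power of `3` with
exponent `t = 0`), so the average of `#Sel_φ(E_s)` and — as `T₀(φ) = T₀(φ̂)` — of `#Sel_{φ̂}(E'_s)`
over `T₀` is `2` (Thm. 2.1); the convexity bound `2r + 1 ≤ 3^r` (BES (8.2)) gives average
`r_φ, r_{φ̂} ≤ ½`; `r₃ ≤ r_φ + r_{φ̂}` (Lemma 9.1 at `ψ = [3]`, BES Prop. 42 (i)) gives average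
`r₃ ≤ 1` on `T₀`; parity (off the finitely many classes with rational `3`-torsion, Mazur–Rubin) and
the Markov step (`squareClassProportionGe_zero_half_of_even_of_averageLe_one`,
`SquareClassAverageMarkovProofs.lean`) give the proportion `≥ ½ μ(T₀)`.

Hypotheses kept explicit (printed claims not typed as facts): `T₀(φ)` is non-empty and "cut out by
finitely many local conditions" (p0014 L33–L34, "From the proof of Theorem (main), we see that `T_m`
is either empty or cut out by finitely many local conditions"), and "`μ(T₀(φ))` denotes the
density" (`HasSquareClassDensity`, as in `thm25_proportions`).

## Main statement

`BhargavaKlagsbrunLemkeOliverShnidman2019.squareClassProportionGe_selmerGroup_trivial_of_facts`: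
granted the four facts, for a `3`-isogeny `φ : E → E'` with dual `φ̂` over a number field (models
with `a₁ = a₃ = 0`), if `T₀(φ)` is non-empty, defined by finitely many local conditions, of density
`μ₀`, then `SquareClassProportionGe (TwistClassSatisfies V (#Sel^{(3)} = 1)) (μ₀ / 2)`.

## References

* [BhargavaKlagsbrunLemkeOliverShnidman2019] Duke Math. J. 168 (2019), §9.1–9.2 (chunk p0014
  L31–L43), Thm. 2.5 (a) (chunk p0005 L16–L19).
* [BhargavaElkiesShnidman2019] J. Lond. Math. Soc. (2) 101 (2020), Thm. 43 with display (8.2)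
  (chunk p0017 L26–L37).
-/

noncomputable section

open scoped Classical NumberField
open Filter Topology
open WeierstrassCurve IsDedekindDomain NumberField

universe u

namespace Literature.NumberTheory.EllipticCurves

/-! ## §1 Arithmetic helpers: powers of `3`, the convexity inequality -/

section Helpers

/-- A finite abelian group killed by a prime `p` has order a power of `p` (it is a `p`-group).
[folklore] -/
private theorem exists_natCard_eq_prime_pow_of_forall_nsmul {H : Type*} [AddCommGroup H] [Finite H]
    {p : ℕ} [Fact p.Prime] (h : ∀ x : H, p • x = 0) : ∃ n : ℕ, Nat.card H = p ^ n := by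
  have hG : _root_.IsPGroup p (_root_.Multiplicative H) := fun g ↦
    ⟨1, by rw [pow_one, ← ofAdd_toAdd g, ← ofAdd_nsmul, h, ofAdd_zero]⟩
  haveI : Finite (_root_.Multiplicative H) := ‹Finite H›
  obtain ⟨n, hn⟩ := (_root_.IsPGroup.iff_card (p := p) (G := _root_.Multiplicative H)).1 hG
  exact ⟨n, hn⟩

/-- **BES (8.2) at `m = 0`**, real form: if `x = 3^r` then `r ≤ (x − 1)/2`, i.e. `2r + 1 ≤ 3^r`
(the convexity inequality behind "the average rank of `Sel_φ(E_s) ⊕ Sel_{φ̂}(E'_s)` … is at most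
`|m| + 3^{−|m|}`"; the integer inequality itself is the tree's
`Literature.Probability.LatticeModels.two_mul_add_one_le_three_pow`, re-derived inline here to keep
the import graph topical). [cite: BhargavaElkiesShnidman2019, Thm. 43, display (8.2) (chunk p0017 L29–L35)] -/
theorem natLog_le_sub_one_div_two {x r : ℕ} (hx : x = 3 ^ r) :
    (Nat.log 3 x : ℝ) ≤ ((x : ℝ) - 1) / 2 := by
  subst hx
  rw [Nat.log_pow (by norm_num : 1 < 3)]
  have h : ∀ n : ℕ, 2 * n + 1 ≤ 3 ^ n := by
    intro n
    induction n with
    | zero => simp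
    | succ n ih =>
      calc 2 * (n + 1) + 1 = (2 * n + 1) + 2 := by ring
        _ ≤ 3 ^ n + 2 * 3 ^ n := by
            have : 1 ≤ 3 ^ n := Nat.one_le_pow _ _ (by norm_num)
            omega
        _ = 3 ^ (n + 1) := by ring
  have h' : (2 * r + 1 : ℝ) ≤ (3 : ℝ) ^ r := by exact_mod_cast h r
  push_cast
  linarith

end Helpers

/-! ## §2 Finite averages over square classes: monotonicity and linearity -/

section Averages

variable {K : Type u} [Field K] [NumberField K]

/-- Monotonicity of the finite averages `(1/|Σ(X)|) ∑_{s ∈ Σ(X)} f(s)` of BKLOS §2 in the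
function. [cite: BhargavaKlagsbrunLemkeOliverShnidman2019, §2 (chunk p0004 L26–L30, avg_Σ and Σ(X))] -/
theorem squareClassAverage_mono {S : Set (SquareClass K)} {f g : SquareClass K → ℝ}
    (h : ∀ t ∈ S, f t ≤ g t) (X : ℕ) : squareClassAverage S f X ≤ squareClassAverage S g X := by
  unfold squareClassAverage
  have hA : {t : SquareClass K | t ∈ S ∧ squareClassHeight t < X}.Finite :=
    (finite_setOf_squareClassHeight_lt X).subset fun t ht ↦ ht.2
  refine div_le_div_of_nonneg_right ?_ (Nat.cast_nonneg _)
  rw [finsum_mem_eq_finite_toFinset_sum f hA, finsum_mem_eq_finite_toFinset_sum g hA]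
  exact Finset.sum_le_sum fun t ht ↦ h t ((Set.Finite.mem_toFinset hA).mp ht).1

/-- Linearity of the finite averages of BKLOS §2: `avg (a f + b g) = a · avg f + b · avg g`.
[cite: BhargavaKlagsbrunLemkeOliverShnidman2019, §2 (chunk p0004 L26–L30, avg_Σ and Σ(X))] -/
theorem squareClassAverage_linear (S : Set (SquareClass K)) (f g : SquareClass K → ℝ) (a b : ℝ)
    (X : ℕ) : squareClassAverage S (fun t ↦ a * f t + b * g t) X =
      a * squareClassAverage S f X + b * squareClassAverage S g X := by
  unfold squareClassAverage
  have hA : {t : SquareClass K | t ∈ S ∧ squareClassHeight t < X}.Finite :=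
    (finite_setOf_squareClassHeight_lt X).subset fun t ht ↦ ht.2
  rw [finsum_mem_eq_finite_toFinset_sum _ hA, finsum_mem_eq_finite_toFinset_sum f hA,
    finsum_mem_eq_finite_toFinset_sum g hA, Finset.sum_add_distrib, ← Finset.mul_sum,
    ← Finset.mul_sum]
  ring

/-- The finite average (BKLOS §2) of a constant is the constant once `Σ(X)` is non-empty.
[cite: BhargavaKlagsbrunLemkeOliverShnidman2019, §2 (chunk p0004 L26–L30, avg_Σ and Σ(X))] -/
theorem squareClassAverage_const {S : Set (SquareClass K)} (c : ℝ) {X : ℕ}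
    (hX : {t : SquareClass K | t ∈ S ∧ squareClassHeight t < X}.Nonempty) :
    squareClassAverage S (fun _ ↦ c) X = c := by
  unfold squareClassAverage
  have hA : {t : SquareClass K | t ∈ S ∧ squareClassHeight t < X}.Finite :=
    (finite_setOf_squareClassHeight_lt X).subset fun t ht ↦ ht.2
  have hcardA : (Nat.card {t : SquareClass K | t ∈ S ∧ squareClassHeight t < X} : ℝ) =
      hA.toFinset.card := by
    rw [Nat.card_coe_set_eq, Set.ncard_eq_toFinset_card _ hA]
  have hne : (hA.toFinset.card : ℝ) ≠ 0 :=
    Nat.cast_ne_zero.mpr (Finset.card_ne_zero.mpr ((Set.Finite.toFinset_nonempty hA).mpr hX))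
  rw [finsum_mem_eq_finite_toFinset_sum _ hA, Finset.sum_const, nsmul_eq_mul, hcardA]
  exact mul_div_cancel_left₀ c hne

/-- `Σ(X) = {s ∈ Σ : H(s) < X}` is eventually non-empty for a non-empty `Σ`.
[cite: BhargavaKlagsbrunLemkeOliverShnidman2019, §2 (chunk p0004 L30, Σ(X))] -/
theorem eventually_nonempty_sep_height_lt {S : Set (SquareClass K)} (hS : S.Nonempty) :
    ∀ᶠ X : ℕ in atTop, {t : SquareClass K | t ∈ S ∧ squareClassHeight t < X}.Nonempty := by
  obtain ⟨t₀, ht₀⟩ := hS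
  refine Filter.eventually_atTop.mpr ⟨squareClassHeight t₀ + 1, fun X hX ↦ ⟨t₀, ht₀, ?_⟩⟩
  exact Nat.lt_of_lt_of_le (Nat.lt_succ_self _) hX

/-- Monotonicity of "the average of `f` over `s ∈ Σ` is at most `B`" (BKLOS Thm. 2.4's
`avg_Σ`-bound shape) in the function. [cite: BhargavaKlagsbrunLemkeOliverShnidman2019, §2 (chunk p0004 L26–L30, avg_Σ)] -/
theorem SquareClassAverageLe.mono {S : Set (SquareClass K)} {f g : SquareClass K → ℝ}
    (h : ∀ t ∈ S, f t ≤ g t) {B : ℝ} (hg : SquareClassAverageLe S g B) :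
    SquareClassAverageLe S f B := fun ε hε ↦
  (hg ε hε).mono fun X hX ↦ (squareClassAverage_mono h X).trans hX

end Averages

/-! ## §3 Powers of `3`: `#Sel₃(E)`, `#Sel_φ(E)`, `#E[φ](K)`, and `c(φ_s) = 1` on `T₀(φ)` -/

section Powers

variable {K : Type u} [Field K] {W W' : WeierstrassCurve K}

/-- `H¹(K, E[φ])` is killed by `deg φ = #E[φ]` (a class is represented by a cocycle with values in
`E[φ]`, killed pointwise by Lagrange) — BKLOS §9: "Each of the groups `Sel_{φᵢ}(A_{i,s})` are
`𝔽₃`-vector spaces" (for `3`-isogenies). [cite: BhargavaKlagsbrunLemkeOliverShnidman2019, §9 (chunk p0014 L22, "are F_3-vector spaces")] -/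
theorem _root_.WeierstrassCurve.Isogeny.degree_nsmul_galH1Ker (φ : Isogeny W W') (c : φ.galH1Ker) : φ.degree • c = 0 := by
  letI := φ.kerAction
  obtain ⟨f, rfl⟩ := GaloisRepresentations.oneCocycleClass_surjective
    (discreteTopRep (Field.absoluteGaloisGroup K) φ.toAddMonoidHom.ker) c
  exact nsmul_oneCocycleClass_eq_zero f φ.degree fun g ↦ card_nsmul_eq_zero'

/-- `#Sel_φ(E/K)` is a power of `p = deg φ` (when finite): BKLOS §9, "Each of the groups
`Sel_{φᵢ}(A_{i,s})` are `𝔽₃`-vector spaces" (degree `3`).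
[cite: BhargavaKlagsbrunLemkeOliverShnidman2019, §9 (chunk p0014 L22, "are F_3-vector spaces")] -/
theorem _root_.WeierstrassCurve.Isogeny.exists_natCard_selmerGroup_eq_pow [NumberField K] (φ : Isogeny W W') {p : ℕ}
    [Fact p.Prime] (hφ : φ.degree = p) [Finite φ.selmerGroup] :
    ∃ r : ℕ, Nat.card φ.selmerGroup = p ^ r :=
  exists_natCard_eq_prime_pow_of_forall_nsmul fun x ↦ Subtype.ext (by
    rw [AddSubgroupClass.coe_nsmul, ← hφ, WeierstrassCurve.Isogeny.degree_nsmul_galH1Ker,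
      AddSubgroup.coe_zero])

/-- `#Sel^{(3)}(E/K)` is a power of `3` (`H¹(K, E[3])` is `3`-torsion, the tree's
`zsmul_discreteH1_torsion`; finiteness is the tree's `finite_selmerGroup_holds`, Silverman X.4.2 (b)).
[cite: SilvermanAEC2009, X.§4 (Thm. X.4.2 (b))] -/
theorem exists_natCard_selmerGroup_three_eq_pow [NumberField K] (W : WeierstrassCurve K)
    [W.IsElliptic] : ∃ r : ℕ, Nat.card (W.selmerGroup 3) = 3 ^ r := by
  haveI : Fact (Nat.Prime 3) := ⟨Nat.prime_three⟩
  haveI : Finite (W.selmerGroup 3) := W.finite_selmerGroup_holds (by norm_num)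
  refine exists_natCard_eq_prime_pow_of_forall_nsmul fun x ↦ Subtype.ext ?_
  rw [AddSubgroupClass.coe_nsmul, AddSubgroup.coe_zero, ← natCast_zsmul]
  exact zsmul_discreteH1_torsion (3 : ℤ) (x : W.galH1Torsion 3)

/-- `#E[φ](K)` is a power of `p = deg φ`: the `Γ_K`-fixed points form a subgroup of `E[φ]`, of
order dividing `p` (Lagrange). [cite: SilvermanAEC2009, III.§4 (Thm. 4.10 (c))] -/
theorem _root_.WeierstrassCurve.Isogeny.exists_ratKerCard_eq_pow (φ : Isogeny W W') {p : ℕ} [hp : Fact p.Prime]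
    (hφ : φ.degree = p) : ∃ e : ℕ, φ.ratKerCard = p ^ e := by
  -- the fixed points as a subgroup of `E[φ]`
  let F : AddSubgroup φ.toAddMonoidHom.ker :=
    { carrier := {P | ∀ σ : Field.absoluteGaloisGroup K, σ • (P : W.geomPoints) = P}
      add_mem' := fun {P Q} hP hQ σ ↦ by
        rw [AddSubgroup.coe_add, smul_add, hP σ, hQ σ]
      zero_mem' := fun σ ↦ by rw [AddSubgroup.coe_zero, smul_zero]
      neg_mem' := fun {P} hP σ ↦ by rw [AddSubgroup.coe_neg, smul_neg, hP σ] }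
  have hcard : φ.ratKerCard = Nat.card F := by
    unfold Isogeny.ratKerCard
    refine Nat.card_congr
      { toFun := fun P ↦ ⟨⟨P.1, by rw [AddMonoidHom.mem_ker, Isogeny.coe_toAddMonoidHom]; exact P.2.1⟩,
          P.2.2⟩
        invFun := fun P ↦ ⟨(P.1 : W.geomPoints), ⟨by
          have := P.1.2; rw [AddMonoidHom.mem_ker, Isogeny.coe_toAddMonoidHom] at this; exact this,
          P.2⟩⟩
        left_inv := fun P ↦ rfl
        right_inv := fun P ↦ rfl }
  have hdvd : Nat.card F ∣ p := by
    rw [← hφ]; exact AddSubgroup.card_addSubgroup_dvd_card F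
  rcases (Nat.dvd_prime hp.out).mp hdvd with h | h
  · exact ⟨0, by rw [hcard, h, pow_zero]⟩
  · exact ⟨1, by rw [hcard, h, pow_one]⟩

open BhargavaKlagsbrunLemkeOliverShnidman2019 in
/-- **`c(φ) = 1` when `t(φ) = 0`** (granted Cassels' formula): `c(φ) = 3^a 3^d / (3^b 3^c)` is a
power of `3` ("the global Selmer ratio `c(φ_s)` lies in `3^ℤ`", BKLOS §2 p0004 L55), so
`ord₃ c(φ) = 0` forces `c(φ) = 1`. [cite: BhargavaKlagsbrunLemkeOliverShnidman2019, §2 (chunk p0004 L55) with §9.1 (chunk p0014 L35–L37)] -/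
theorem selmerRatio_eq_one_of_logSelmerRatio_eq_zero (hC : casselsFormula_selmerRatio)
    {K : Type} [Field K] [NumberField K] {V V' : WeierstrassCurve K} [V.IsElliptic]
    [V'.IsElliptic] (φ : Isogeny V V') (ψ : Isogeny V' V) (hφ : φ.degree = 3) (hψ : ψ.degree = 3)
    (hψφ : ∀ P, ψ (φ P) = (3 : ℤ) • P) (hlog : logSelmerRatio φ = 0) : selmerRatio φ = 1 := by
  haveI : Fact (Nat.Prime 3) := ⟨Nat.prime_three⟩
  obtain ⟨hf₁, hf₂, hE⟩ := hC K V V' φ ψ hφ hψφ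
  obtain ⟨a, ha⟩ := φ.exists_natCard_selmerGroup_eq_pow hφ
  obtain ⟨b, hb⟩ := ψ.exists_natCard_selmerGroup_eq_pow hψ
  obtain ⟨c, hc⟩ := φ.exists_ratKerCard_eq_pow hφ
  obtain ⟨d, hd⟩ := ψ.exists_ratKerCard_eq_pow hψ
  rw [ha, hb, hc, hd] at hE
  push_cast at hE
  have h3 : (3 : ℚ) ≠ 0 := by norm_num
  have hbc : (3 : ℚ) ^ b * (3 : ℚ) ^ c ≠ 0 := by positivity
  have heq : selmerRatio φ = (3 : ℚ) ^ (a + d) / (3 : ℚ) ^ (b + c) := by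
    rw [eq_div_iff (by positivity), pow_add, pow_add, ← hE]; ring
  have h33 : padicValRat 3 (3 : ℚ) = 1 := by
    have := padicValRat.self (p := 3) (by norm_num)
    simpa using this
  have hval : padicValRat 3 (selmerRatio φ) = ((a + d : ℕ) : ℤ) - ((b + c : ℕ) : ℤ) := by
    rw [heq, padicValRat.div (by positivity) (by positivity), padicValRat.pow, padicValRat.pow,
      h33]
    push_cast
    ring
  unfold logSelmerRatio at hlog
  rw [hlog] at hval
  have hadbc : a + d = b + c := by omega
  rw [heq, hadbc, div_self (by positivity)]

end Powers

/-! ## §4 Theorem 2.5 (a) in Selmer form, from the four facts -/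

namespace BhargavaKlagsbrunLemkeOliverShnidman2019

variable {K : Type} [Field K] [NumberField K] {V V' : WeierstrassCurve K} [V.IsElliptic]
  [V'.IsElliptic] [V.IsCharNeTwoNF] [V'.IsCharNeTwoNF]

/-- On `T₀(φ)` the Selmer ratio of the twist is `1` (granted Cassels' formula), so its finite
averages over `T₀(φ)(X)` tend to `1`: the hypothesis of Thm. 2.1 with `a = 1`.
[cite: BhargavaKlagsbrunLemkeOliverShnidman2019, §9.1 (chunk p0014 L33–L35, "the average size of Sel_φ(E_s) for s ∈ T_m is 1 + 3^m")] -/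
theorem tendsto_squareClassAverage_twistSelmerRatio_T0 (hC : casselsFormula_selmerRatio)
    (φ : Isogeny V V') (ψ : Isogeny V' V) (hφ : φ.degree = 3) (hψ : ψ.degree = 3)
    (hψφ : ∀ P, ψ (φ P) = (3 : ℤ) • P)
    (hne : {t : SquareClass K | IsInSelmerRatioClass φ 0 t}.Nonempty) :
    Tendsto (squareClassAverage {t | IsInSelmerRatioClass φ 0 t} (twistSelmerRatio φ)) atTop
      (𝓝 1) := by
  have hconst : ∀ t ∈ {t : SquareClass K | IsInSelmerRatioClass φ 0 t},
      twistSelmerRatio φ t = (fun _ ↦ (1 : ℝ)) t := by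
    intro t ht
    have hs := Units.ne_zero (Quotient.out t : Kˣ)
    haveI := V.isElliptic_quadraticTwist hs
    haveI := V'.isElliptic_quadraticTwist hs
    have hlog : logSelmerRatio (φ.quadraticTwist hs) = 0 := by
      have h0 := ht (Quotient.out t) (QuotientGroup.out_eq' t)
      exact Int.natAbs_eq_zero.mp h0
    have h1 := selmerRatio_eq_one_of_logSelmerRatio_eq_zero hC (φ.quadraticTwist hs)
      (ψ.quadraticTwist hs) (by rw [Isogeny.degree_quadraticTwist, hφ])
      (by rw [Isogeny.degree_quadraticTwist, hψ])
      (Isogeny.quadraticTwist_comp_quadraticTwist φ ψ hψφ hs) hlog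
    simp only [twistSelmerRatio, h1, Rat.cast_one]
  have hev := eventually_nonempty_sep_height_lt hne
  refine (tendsto_congr' (hev.mono fun X hX ↦ ?_)).mpr tendsto_const_nhds
  rw [show squareClassAverage {t | IsInSelmerRatioClass φ 0 t} (twistSelmerRatio φ) X =
      squareClassAverage {t | IsInSelmerRatioClass φ 0 t} (fun _ ↦ (1 : ℝ)) X from
    le_antisymm (squareClassAverage_mono (fun t ht ↦ (hconst t ht).le) X)
      (squareClassAverage_mono (fun t ht ↦ (hconst t ht).ge) X),
    squareClassAverage_const 1 hX]

/-- **"The average of the rank of `Sel₃(E_s)` for `s ∈ T₀(φ)` is at most `1`"** (BKLOS §9.2, p0014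
L43; proved in §9.1), derived from Thm. 2.1, Cassels' formula and Lemma 9.1: the `3`-Selmer rank of
the twist at a representative, `log₃ #Sel^{(3)}(E_s)`, has `limsup` of its `T₀`-averages `≤ 1`.
[cite: BhargavaKlagsbrunLemkeOliverShnidman2019, §9.1–9.2 (chunk p0014 L33–L43)] -/
theorem squareClassAverageLe_selmerRankThree_T0 (h21 : thm21_averageCard_selmerGroup)
    (hC : casselsFormula_selmerRatio) (h91 : lemma91_selmerGroup_exact) (φ : Isogeny V V')
    (ψ : Isogeny V' V) (hφ : φ.degree = 3) (hψ : ψ.degree = 3)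
    (hψφ : ∀ P, ψ (φ P) = (3 : ℤ) • P) (hφψ : ∀ Q, φ (ψ Q) = (3 : ℤ) • Q)
    (hne : {t : SquareClass K | IsInSelmerRatioClass φ 0 t}.Nonempty)
    (hloc : IsDefinedByFinitelyManyLocalConditions {t : SquareClass K | IsInSelmerRatioClass φ 0 t}) :
    SquareClassAverageLe {t | IsInSelmerRatioClass φ 0 t}
      (fun t ↦ (Nat.log 3 (Nat.card
        ((V.quadraticTwist ((Quotient.out t : Kˣ) : K)).selmerGroup 3)) : ℝ)) 1 := by
  haveI : Fact (Nat.Prime 3) := ⟨Nat.prime_three⟩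
  set S : Set (SquareClass K) := {t | IsInSelmerRatioClass φ 0 t} with hSdef
  -- `T₀(φ) = T₀(φ̂)`
  have hS' : {t : SquareClass K | IsInSelmerRatioClass ψ 0 t} = S :=
    Set.ext fun t ↦ (isInSelmerRatioClass_dual_iff hC φ ψ hφ hψ hψφ hφψ 0 t).symm
  -- Thm 2.1 for `φ` and for `φ̂` over `T₀`: averages of `#Sel` tend to `2`.
  have hφ2 : Tendsto (squareClassAverage S (twistSelmerCard φ)) atTop (𝓝 (1 + 1)) :=
    h21 K V V' φ hφ S hne hloc 1
      (tendsto_squareClassAverage_twistSelmerRatio_T0 hC φ ψ hφ hψ hψφ hne)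
  have hψ2 : Tendsto (squareClassAverage S (twistSelmerCard ψ)) atTop (𝓝 (1 + 1)) := by
    have hne' : {t : SquareClass K | IsInSelmerRatioClass ψ 0 t}.Nonempty := by rwa [hS']
    have := h21 K V' V ψ hψ _ hne' (by rwa [hS']) 1
      (tendsto_squareClassAverage_twistSelmerRatio_T0 hC ψ φ hψ hφ hφψ hne')
    rwa [hS'] at this
  -- pointwise: `r₃ ≤ (#Sel_φ - 1)/2 + (#Sel_ψ - 1)/2` at every class.
  have hpt : ∀ t ∈ S,
      (Nat.log 3 (Nat.card ((V.quadraticTwist ((Quotient.out t : Kˣ) : K)).selmerGroup 3)) : ℝ) ≤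
        (1 / 2) * twistSelmerCard φ t + (1 / 2) * twistSelmerCard ψ t + (-1) := by
    intro t _
    have hs := Units.ne_zero (Quotient.out t : Kˣ)
    haveI := V.isElliptic_quadraticTwist hs
    haveI := V'.isElliptic_quadraticTwist hs
    set φ' := φ.quadraticTwist hs
    set ψ' := ψ.quadraticTwist hs
    have hφ' : φ'.degree = 3 := by rw [Isogeny.degree_quadraticTwist, hφ]
    have hψ' : ψ'.degree = 3 := by rw [Isogeny.degree_quadraticTwist, hψ]
    have hψφ' : ∀ P, ψ' (φ' P) = (3 : ℤ) • P :=
      Isogeny.quadraticTwist_comp_quadraticTwist φ ψ hψφ hs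
    have hφψ' : ∀ Q, φ' (ψ' Q) = (3 : ℤ) • Q :=
      Isogeny.quadraticTwist_comp_quadraticTwist ψ φ hφψ hs
    haveI : Finite φ'.selmerGroup := finite_selmerGroup_of_lemma91 h91 φ' ψ' (by norm_num) hψφ'
    haveI : Finite ψ'.selmerGroup := finite_selmerGroup_of_lemma91 h91 ψ' φ' (by norm_num) hφψ'
    obtain ⟨a, ha⟩ := φ'.exists_natCard_selmerGroup_eq_pow hφ'
    obtain ⟨b, hb⟩ := ψ'.exists_natCard_selmerGroup_eq_pow hψ'
    obtain ⟨r, hr⟩ :=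
      exists_natCard_selmerGroup_three_eq_pow (V.quadraticTwist ((Quotient.out t : Kˣ) : K))
    -- `r ≤ a + b` from `3^r ≤ 3^a 3^b` (Lemma 9.1 / BES Prop 42 (i))
    have hle := natCard_selmerGroup_three_le_of_lemma91 h91 φ' ψ' hψφ' hφψ'
    rw [hr, ha, hb, ← pow_add] at hle
    have hrab : r ≤ a + b := (Nat.pow_le_pow_iff_right (by norm_num)).mp hle
    have h1 : (Nat.log 3 (3 ^ r) : ℝ) = r := by rw [Nat.log_pow (by norm_num)]
    have h2 : (a : ℝ) ≤ ((3 : ℝ) ^ a - 1) / 2 := by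
      have := natLog_le_sub_one_div_two (x := 3 ^ a) (r := a) rfl
      rwa [Nat.log_pow (by norm_num), Nat.cast_pow, Nat.cast_ofNat] at this
    have h3 : (b : ℝ) ≤ ((3 : ℝ) ^ b - 1) / 2 := by
      have := natLog_le_sub_one_div_two (x := 3 ^ b) (r := b) rfl
      rwa [Nat.log_pow (by norm_num), Nat.cast_pow, Nat.cast_ofNat] at this
    have hcφ : twistSelmerCard φ t = (3 : ℝ) ^ a := by
      change ((Nat.card φ'.selmerGroup : ℕ) : ℝ) = _
      rw [ha, Nat.cast_pow, Nat.cast_ofNat]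
    have hcψ : twistSelmerCard ψ t = (3 : ℝ) ^ b := by
      change ((Nat.card ψ'.selmerGroup : ℕ) : ℝ) = _
      rw [hb, Nat.cast_pow, Nat.cast_ofNat]
    rw [hr, h1, hcφ, hcψ]
    have : (r : ℝ) ≤ a + b := by exact_mod_cast hrab
    linarith
  -- pass to averages: eventually `avg r₃ ≤ ½ avg #Sel_φ + ½ avg #Sel_ψ - 1 ≤ 1 + ε`.
  intro ε hε
  have hevφ := (tendsto_order.1 hφ2).2 (2 + ε) (by linarith)
  have hevψ := (tendsto_order.1 hψ2).2 (2 + ε) (by linarith)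
  filter_upwards [hevφ, hevψ, eventually_nonempty_sep_height_lt hne] with X hXφ hXψ hXne
  calc squareClassAverage S _ X
      ≤ squareClassAverage S
          (fun t ↦ (1 / 2) * twistSelmerCard φ t + (1 / 2) * twistSelmerCard ψ t + (-1)) X :=
        squareClassAverage_mono hpt X
    _ = (1 / 2) * squareClassAverage S (twistSelmerCard φ) X +
          (1 / 2) * squareClassAverage S (twistSelmerCard ψ) X + (-1) := by
        have hlin := squareClassAverage_linear S
          (fun t ↦ (1 / 2) * twistSelmerCard φ t + (1 / 2) * twistSelmerCard ψ t)
          (fun _ ↦ (-1 : ℝ)) 1 1 X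
        simp only [one_mul] at hlin
        rw [hlin, squareClassAverage_linear S (twistSelmerCard φ) (twistSelmerCard ψ) _ _ X,
          squareClassAverage_const (-1) hXne]
    _ ≤ 1 + ε := by linarith

/-- **BKLOS Theorem 2.5 (a) in SELMER form, derived in the kernel** (the §9.2 argument: "every
twist within `T₀(φ)` has even `3`-Selmer rank, so it follows that at least `50%` of the twists in
`T₀(φ)` have [`Sel₃ = 0`, hence] rank `0`"): granted the four REFEREED facts (Thm. 2.1, Cassels'
formula, the parity of BES Prop. 42 (ii), Lemma 9.1), for a `3`-isogeny `φ : E → E'` with dual `φ̂`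
over a number field (models with `a₁ = a₃ = 0`), if `T₀(φ)` is non-empty, cut out by finitely many
local conditions (p0014 L33–L34) and of density `μ₀`, then at least `μ₀/2` of all square classes
`t` have `#Sel^{(3)}(E_s/K) = 1` for every representative `s` of `t`. The finitely many classes
with `E_s(K)[3] ≠ 0` (where the parity input is not available) are discarded by
`SquareClassProportionGe.of_imp_off_finite` (Mazur–Rubin 2010 L.5.5).
[cite: BhargavaKlagsbrunLemkeOliverShnidman2019, Thm. 2.5 (a) (chunk p0005 L16–L19) with §9.2 (chunk p0014 L43)] -/
theorem squareClassProportionGe_selmerGroup_trivial_of_facts (h21 : thm21_averageCard_selmerGroup)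
    (hC : casselsFormula_selmerRatio) (hP : selmerRank_parity_of_isInSelmerRatioClass)
    (h91 : lemma91_selmerGroup_exact) (φ : Isogeny V V') (ψ : Isogeny V' V) (hφ : φ.degree = 3)
    (hψ : ψ.degree = 3) (hψφ : ∀ P, ψ (φ P) = (3 : ℤ) • P) (hφψ : ∀ Q, φ (ψ Q) = (3 : ℤ) • Q)
    (hne : {t : SquareClass K | IsInSelmerRatioClass φ 0 t}.Nonempty)
    (hloc : IsDefinedByFinitelyManyLocalConditions {t : SquareClass K | IsInSelmerRatioClass φ 0 t})
    {μ₀ : ℝ} (hμ : HasSquareClassDensity (IsInSelmerRatioClass φ 0) μ₀) :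
    SquareClassProportionGe
      (TwistClassSatisfies V fun E : WeierstrassCurve K ↦ Nat.card (E.selmerGroup 3) = 1)
      (μ₀ / 2) := by
  set S : Set (SquareClass K) := {t | IsInSelmerRatioClass φ 0 t} with hSdef
  -- the `3`-Selmer rank at the representative, and its modification off the exceptional set
  set r₃ : SquareClass K → ℕ := fun t ↦
    Nat.log 3 (Nat.card ((V.quadraticTwist ((Quotient.out t : Kˣ) : K)).selmerGroup 3)) with hr₃
  set F : Set (SquareClass K) := {t : SquareClass K | ¬ (IsInSelmerRatioClass φ 0 t →
      ∀ s : Kˣ, (QuotientGroup.mk s : SquareClass K) = t →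
        ∃ j : ℕ, Nat.card ((V.quadraticTwist (s : K)).selmerGroup 3) = 9 ^ j)} with hFdef
  have hF : F.Finite := eventually_even_selmerRank_on_T0 hP φ hφ
  set f : SquareClass K → ℕ := fun t ↦ if t ∈ F then 0 else r₃ t with hfdef
  -- `f` is even on `S`
  have hpow : ∀ t : SquareClass K, ∃ r, Nat.card
      ((V.quadraticTwist ((Quotient.out t : Kˣ) : K)).selmerGroup 3) = 3 ^ r := fun t ↦ by
    haveI := V.isElliptic_quadraticTwist (Units.ne_zero (Quotient.out t : Kˣ))
    exact exists_natCard_selmerGroup_three_eq_pow _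
  have heven : ∀ t ∈ S, Even (f t) := by
    intro t ht
    by_cases htF : t ∈ F
    · simp only [hfdef, htF, if_true]; exact ⟨0, rfl⟩
    · simp only [hfdef, htF, if_false, hr₃]
      have hgood : IsInSelmerRatioClass φ 0 t → ∀ s : Kˣ, (QuotientGroup.mk s : SquareClass K) = t →
          ∃ j : ℕ, Nat.card ((V.quadraticTwist (s : K)).selmerGroup 3) = 9 ^ j := by
        by_contra hbad; exact htF hbad
      obtain ⟨j, hj⟩ := hgood ht (Quotient.out t) (QuotientGroup.out_eq' t)
      rw [hj, show (9 : ℕ) ^ j = 3 ^ (2 * j) by rw [pow_mul]; norm_num,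
        Nat.log_pow (by norm_num)]
      exact even_two_mul j
  -- average of `f` over `S` is at most `1` (`f ≤ r₃`)
  have hfle : ∀ t ∈ S, (f t : ℝ) ≤ (r₃ t : ℝ) := by
    intro t _
    by_cases htF : t ∈ F
    · simp only [hfdef, htF, if_true, Nat.cast_zero]; exact Nat.cast_nonneg _
    · simp only [hfdef, htF, if_false]; exact le_rfl
  have havg : SquareClassAverageLe S (fun t ↦ (f t : ℝ)) 1 :=
    SquareClassAverageLe.mono hfle
      (squareClassAverageLe_selmerRankThree_T0 h21 hC h91 φ ψ hφ hψ hψφ hφψ hne hloc)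
  -- Markov–parity step
  have hprop : SquareClassProportionGe (fun t ↦ t ∈ S ∧ f t = 0) (μ₀ / 2) :=
    squareClassProportionGe_zero_half_of_even_of_averageLe_one hμ heven havg
  -- off `F`, `t ∈ S ∧ f t = 0` gives `#Sel₃(E_s) = 1` for every representative `s`
  refine SquareClassProportionGe.of_imp_off_finite hF (fun t htF ht ↦ ?_) hprop
  obtain ⟨-, hft⟩ := ht
  simp only [hfdef, htF, if_false, hr₃] at hft
  obtain ⟨r, hr⟩ := hpow t
  rw [hr, Nat.log_pow (by norm_num)] at hft
  subst hft
  rw [pow_zero] at hr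
  intro s hs
  exact (natCard_selmerGroup_quadraticTwist_eq_of_mk_eq V (n := 3) (by norm_num)
    (hs.trans (QuotientGroup.out_eq' t).symm)).trans hr

/-! ### Appendix: the non-emptiness hypothesis is redundant -/

/-- An empty family has density `0`: if `T₀(φ) = ∅` then "`μ(T₀(φ))` denotes the density" forces
`μ₀ = 0`. [cite: BhargavaKlagsbrunLemkeOliverShnidman2019, §2 (chunk p0005 L14, the density μ(T_m(φ)))] -/
theorem hasSquareClassDensity_empty_eq_zero {P : SquareClass K → Prop} (hP : ∀ t, ¬ P t) {μ : ℝ}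
    (hμ : HasSquareClassDensity P μ) : μ = 0 := by
  have h0 : ∀ X, squareClassProportion P X = 0 := by
    intro X
    unfold squareClassProportion
    have : {t : SquareClass K | squareClassHeight t < X ∧ P t} = ∅ :=
      Set.eq_empty_of_forall_notMem fun t ht ↦ hP t ht.2
    rw [this, Set.empty_def]
    simp
  have hconst : Tendsto (squareClassProportion P) atTop (𝓝 (0 : ℝ)) :=
    (tendsto_congr h0).mpr tendsto_const_nhds
  exact tendsto_nhds_unique hμ hconst

/-- **BKLOS Theorem 2.5 (a) in SELMER form, without the non-emptiness hypothesis** (if `T₀(φ)` is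
empty, its density is `0` and the conclusion "proportion `≥ 0`" is trivial; otherwise
`squareClassProportionGe_selmerGroup_trivial_of_facts`). Granted the four REFEREED facts, for a
`3`-isogeny dual pair `(φ, φ̂)` with `T₀(φ)` cut out by finitely many local conditions and of
density `μ₀`: at least `μ₀/2` of all square classes carry twists with `Sel^{(3)}(E_s/K) = 0`.
[cite: BhargavaKlagsbrunLemkeOliverShnidman2019, Thm. 2.5 (a) (chunk p0005 L16–L19) with §9.2 (chunk p0014 L43)] -/
theorem squareClassProportionGe_selmerGroup_trivial_of_facts'
    (h21 : thm21_averageCard_selmerGroup) (hC : casselsFormula_selmerRatio)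
    (hP : selmerRank_parity_of_isInSelmerRatioClass) (h91 : lemma91_selmerGroup_exact)
    (φ : Isogeny V V') (ψ : Isogeny V' V) (hφ : φ.degree = 3) (hψ : ψ.degree = 3)
    (hψφ : ∀ P, ψ (φ P) = (3 : ℤ) • P) (hφψ : ∀ Q, φ (ψ Q) = (3 : ℤ) • Q)
    (hloc : IsDefinedByFinitelyManyLocalConditions {t : SquareClass K | IsInSelmerRatioClass φ 0 t})
    {μ₀ : ℝ} (hμ : HasSquareClassDensity (IsInSelmerRatioClass φ 0) μ₀) :
    SquareClassProportionGe
      (TwistClassSatisfies V fun E : WeierstrassCurve K ↦ Nat.card (E.selmerGroup 3) = 1)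
      (μ₀ / 2) := by
  by_cases hne : {t : SquareClass K | IsInSelmerRatioClass φ 0 t}.Nonempty
  · exact squareClassProportionGe_selmerGroup_trivial_of_facts h21 hC hP h91 φ ψ hφ hψ hψφ hφψ
      hne hloc hμ
  · have hempty : ∀ t, ¬ IsInSelmerRatioClass φ 0 t := fun t ht ↦ hne ⟨t, ht⟩
    have hμ0 : μ₀ = 0 := hasSquareClassDensity_empty_eq_zero hempty hμ
    exact squareClassProportionGe_of_nonpos _ (by rw [hμ0]; norm_num)

end BhargavaKlagsbrunLemkeOliverShnidman2019

end Literature.NumberTheory.EllipticCurves
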